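import Literature.Analysis.ODE.BarrierDepth
import HarnessLib

/-!
# The diagonal product `g d / w₀` of the barrier basis OFF the good sub-interval: linear growth of the
# reciprocal rate by convexity, and the interior rate on the whole barrier

Topic `Literature/Analysis/ODE` (namespace `Literature.Analysis.ODE`), continuing `BarrierRates.lean` and
`BarrierDepth.lean`. Setting: the monotone two-end real basis `g, d` of `y″ = q y` on a forbidden interval
`[α, β]` (`q ≥ 0`; `g ≥ 1` non-decreasing, `g′(α) = 0`; `d ≥ 1` non-increasing, `d′(β) = 0`; Wronskian
`g′ d − g d′ ≡ w₀`), and ONE good sub-interval `[t₁, t₂] ⊆ [α, β]` where `q ≥ k² > 0`.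
`BarrierDepth.barrierBasis_depth_and_rates` gives the interior rate `g d ≤ (4/k)·w₀` ON `[t₁, t₂]` only.
OFF the good interval no positive floor of `q` is available (the ends are turning points), but the
reciprocal rates `d/(−d′)` and `g/g′` grow at most LINEARLY away from the good interval — the Riccati
variable `r = −d′/d` has `(1/r)′ = −1 + q/r² ≥ −1` — which in convexity language is:

* `mul_le_of_left_tail` — for `x ∈ [α, t₁]`: `g(x)d(x) ≤ ((t₁ − x) + 1/(k tanh(k(t₂ − t₁))))·w₀`
  (`d(x) ≤ d(t₁) + (t₁ − x)(−d′(x))` by convexity, `−d′(t₁) ≥ k tanh·d(t₁)`, `−d′(x) ≥ −d′(t₁)`, and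
  `w₀ ≥ g(x)(−d′(x))`);
* `mul_le_of_right_tail` — the mirror statement for `x ∈ [t₂, β]`:
  `g(x)d(x) ≤ ((x − t₂) + 1/(k tanh(k(t₂ − t₁))))·w₀`;
* `barrierBasis_interior_rate` — with `k(t₂ − t₁) ≥ 2`: for EVERY `x ∈ [α, β]`,
  `g(x)d(x) ≤ ((t₁ − α) + (β − t₂) + 4/k)·w₀`.

So the interior reciprocal rate `R_m` consumed by `DeepBarrierKernelBound.kernel_le_of_deep_barrier` is
the tortoise length of the barrier outside the good interval plus `4/k`; no Airy analysis at the turning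
points is needed. One-interval real analysis; all proved.

## References
* P. Hartman, *Ordinary Differential Equations* (SIAM Classics 38, 2002), Ch. XI Thm. 3.2, Ex. 3.1(a),
  §6 (convex positive solutions, Riccati comparison). Key `Hartman2002`. Folklore.
-/

noncomputable section

open Set

namespace Literature.Analysis.ODE

/-! ### Off the good interval: linear growth of the reciprocal rates -/

/-- **Left tail.** Let `d″ = q d` on `[α, β]` with `q ≥ 0`, and `g ≥ 0`, `g′ ≥ 0`, `d ≥ 0`, `d′ ≤ 0`
there with Wronskian `g d′ − g′ d ≡ −w₀`; let `α ≤ t₁ < t₂ ≤ β` with `q ≥ k²` (`k > 0`) on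
`[t₁, t₂]`. Then for every `x ∈ [α, t₁]`: `g(x)d(x) ≤ ((t₁ − x) + 1/(k·tanh(k(t₂ − t₁))))·w₀`.
[folklore] -/
theorem mul_le_of_left_tail {q g g' d d' : ℝ → ℝ} {α β w₀ t₁ t₂ k : ℝ}
    (hd : ∀ x ∈ Icc α β, HasDerivAt d (d' x) x ∧ HasDerivAt d' (q x * d x) x)
    (hq0 : ∀ x ∈ Icc α β, 0 ≤ q x)
    (hg0 : ∀ x ∈ Icc α β, 0 ≤ g x) (hg'0 : ∀ x ∈ Icc α β, 0 ≤ g' x)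
    (hd0 : ∀ x ∈ Icc α β, 0 ≤ d x) (hd'0 : ∀ x ∈ Icc α β, d' x ≤ 0)
    (hW : ∀ x ∈ Icc α β, g x * d' x - g' x * d x = -w₀)
    (hαt : α ≤ t₁) (ht : t₁ < t₂) (htβ : t₂ ≤ β) (hk : 0 < k) (hqk : ∀ s ∈ Icc t₁ t₂, k ^ 2 ≤ q s)
    {x : ℝ} (hx : x ∈ Icc α t₁) :
    g x * d x ≤ ((t₁ - x) + 1 / (k * Real.tanh (k * (t₂ - t₁)))) * w₀ := by
  have hαβ : α ≤ β := hαt.trans (ht.le.trans htβ)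
  have hxI : x ∈ Icc α β := ⟨hx.1, hx.2.trans (ht.le.trans htβ)⟩
  have ht₁I : t₁ ∈ Icc α β := ⟨hαt, ht.le.trans htβ⟩
  have hsub₂ : Icc t₁ t₂ ⊆ Icc α β := Icc_subset_Icc hαt htβ
  have hsubx : Icc x t₁ ⊆ Icc α β := Icc_subset_Icc hx.1 (ht.le.trans htβ)
  obtain ⟨hr0, -⟩ := tanh_rate_pos_and_inv_le hk (sub_pos.2 ht)
  set T := 1 / (k * Real.tanh (k * (t₂ - t₁))) with hT
  have hT0 : 0 ≤ T := by rw [hT]; positivity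
  -- the rate at `t₁`
  have h1 : k * Real.tanh (k * (t₂ - t₁)) * d t₁ ≤ -d' t₁ :=
    tanh_mul_le_neg_deriv (fun s hs ↦ hd s (hsub₂ hs)) hqk (fun s hs ↦ hd0 s (hsub₂ hs))
      (hd'0 t₂ ⟨hαt.trans ht.le, htβ⟩) t₁ (left_mem_Icc.2 ht.le)
  -- `−d′` only grows towards `α`
  have h2 : d' x ≤ d' t₁ := deriv_monotoneOn_of_nonneg hd hq0 hd0 hxI ht₁I hx.2
  -- convexity on `[x, t₁]`
  have h3 : d x ≤ d t₁ + (t₁ - x) * (-d' x) :=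
    le_add_mul_neg_deriv_of_convex hx.2 (fun s hs ↦ hd s (hsubx hs)) (fun s hs ↦ hq0 s (hsubx hs))
      fun s hs ↦ hd0 s (hsubx hs)
  -- `d(t₁) ≤ T·(−d′(t₁)) ≤ T·(−d′(x))`
  have h4 : d t₁ ≤ T * (-d' x) := by
    have h5 : d t₁ ≤ T * (-d' t₁) := by
      rw [hT, one_div, ← div_eq_inv_mul, le_div_iff₀ hr0]; linarith
    exact h5.trans (mul_le_mul_of_nonneg_left (by linarith) hT0)
  -- `w₀ ≥ g(x)(−d′(x))`
  have hgx : 0 ≤ g x := hg0 x hxI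
  have hpx : 0 ≤ -d' x := by linarith [hd'0 x hxI]
  have h6 : g x * (-d' x) ≤ w₀ := by
    have := hW x hxI
    have : 0 ≤ g' x * d x := mul_nonneg (hg'0 x hxI) (hd0 x hxI)
    linarith
  calc g x * d x ≤ g x * (T * (-d' x) + (t₁ - x) * (-d' x)) :=
        mul_le_mul_of_nonneg_left (by linarith) hgx
    _ = ((t₁ - x) + T) * (g x * (-d' x)) := by ring
    _ ≤ ((t₁ - x) + T) * w₀ := mul_le_mul_of_nonneg_left h6 (by linarith [hx.2])

/-- **Right tail.** With `g″ = q g` on `[α, β]` instead, under the same sign and Wronskian hypotheses,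
for every `x ∈ [t₂, β]`:
`g(x)d(x) ≤ ((x − t₂) + 1/(k·tanh(k(t₂ − t₁))))·w₀`. [folklore] -/
theorem mul_le_of_right_tail {q g g' d d' : ℝ → ℝ} {α β w₀ t₁ t₂ k : ℝ}
    (hg : ∀ x ∈ Icc α β, HasDerivAt g (g' x) x ∧ HasDerivAt g' (q x * g x) x)
    (hq0 : ∀ x ∈ Icc α β, 0 ≤ q x)
    (hg0 : ∀ x ∈ Icc α β, 0 ≤ g x) (hg'0 : ∀ x ∈ Icc α β, 0 ≤ g' x)
    (hd0 : ∀ x ∈ Icc α β, 0 ≤ d x) (hd'0 : ∀ x ∈ Icc α β, d' x ≤ 0)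
    (hW : ∀ x ∈ Icc α β, g x * d' x - g' x * d x = -w₀)
    (hαt : α ≤ t₁) (ht : t₁ < t₂) (htβ : t₂ ≤ β) (hk : 0 < k) (hqk : ∀ s ∈ Icc t₁ t₂, k ^ 2 ≤ q s)
    {x : ℝ} (hx : x ∈ Icc t₂ β) :
    g x * d x ≤ ((x - t₂) + 1 / (k * Real.tanh (k * (t₂ - t₁)))) * w₀ := by
  have hxI : x ∈ Icc α β := ⟨(hαt.trans ht.le).trans hx.1, hx.2⟩
  have ht₂I : t₂ ∈ Icc α β := ⟨hαt.trans ht.le, htβ⟩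
  have hsub₂ : Icc t₁ t₂ ⊆ Icc α β := Icc_subset_Icc hαt htβ
  have hsubx : Icc t₂ x ⊆ Icc α β := Icc_subset_Icc (hαt.trans ht.le) hx.2
  obtain ⟨hr0, -⟩ := tanh_rate_pos_and_inv_le hk (sub_pos.2 ht)
  set T := 1 / (k * Real.tanh (k * (t₂ - t₁))) with hT
  have hT0 : 0 ≤ T := by rw [hT]; positivity
  -- the rate at `t₂`
  have h1 : k * Real.tanh (k * (t₂ - t₁)) * g t₂ ≤ g' t₂ :=
    tanh_mul_le_deriv (fun s hs ↦ hg s (hsub₂ hs)) hqk (fun s hs ↦ hg0 s (hsub₂ hs))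
      (hg'0 t₁ ⟨hαt, ht.le.trans htβ⟩) t₂ (right_mem_Icc.2 ht.le)
  -- `g′` only grows towards `β`
  have h2 : g' t₂ ≤ g' x := deriv_monotoneOn_of_nonneg hg hq0 hg0 ht₂I hxI hx.1
  -- convexity on `[t₂, x]`
  have h3 : g x ≤ g t₂ + (x - t₂) * g' x :=
    le_add_mul_deriv_of_convex hx.1 (fun s hs ↦ hg s (hsubx hs)) (fun s hs ↦ hq0 s (hsubx hs))
      fun s hs ↦ hg0 s (hsubx hs)
  have h4 : g t₂ ≤ T * g' x := by
    have h5 : g t₂ ≤ T * g' t₂ := by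
      rw [hT, one_div, ← div_eq_inv_mul, le_div_iff₀ hr0]; linarith
    exact h5.trans (mul_le_mul_of_nonneg_left h2 hT0)
  have hdx : 0 ≤ d x := hd0 x hxI
  have hg'x : 0 ≤ g' x := hg'0 x hxI
  have h6 : g' x * d x ≤ w₀ := by
    have := hW x hxI
    have : 0 ≤ g x * (-d' x) := mul_nonneg (hg0 x hxI) (by linarith [hd'0 x hxI])
    linarith
  calc g x * d x ≤ (T * g' x + (x - t₂) * g' x) * d x :=
        mul_le_mul_of_nonneg_right (by linarith) hdx
    _ = ((x - t₂) + T) * (g' x * d x) := by ring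
    _ ≤ ((x - t₂) + T) * w₀ := mul_le_mul_of_nonneg_left h6 (by linarith [hx.1])

/-! ### The interior rate on the whole barrier -/

/-- **Interior reciprocal rate of the barrier basis on the whole barrier.** For the monotone two-end
basis `g, d` of `y″ = q y` on `[α, β]` (`q ≥ 0`; `g ≥ 1`, `g′ ≥ 0`, `d ≥ 1`, `d′ ≤ 0`; `g(α) = 1`,
`g′(α) = 0`, `g′(β) = w₀`, Wronskian `g d′ − g′ d ≡ −w₀`) and a sub-interval `α ≤ t₁ < t₂ ≤ β` with
`q ≥ k²` (`k > 0`) on it and `k(t₂ − t₁) ≥ 2`: for every `x ∈ [α, β]`,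
`g(x)d(x) ≤ ((t₁ − α) + (β − t₂) + 4/k)·w₀`. [folklore] -/
theorem barrierBasis_interior_rate {q g g' d d' : ℝ → ℝ} {α β w₀ t₁ t₂ k : ℝ}
    (hg : ∀ x ∈ Icc α β, HasDerivAt g (g' x) x ∧ HasDerivAt g' (q x * g x) x)
    (hd : ∀ x ∈ Icc α β, HasDerivAt d (d' x) x ∧ HasDerivAt d' (q x * d x) x)
    (hq0 : ∀ x ∈ Icc α β, 0 ≤ q x) (hgα : g α = 1) (hg'α : g' α = 0) (hg'β : g' β = w₀)
    (hsign : ∀ x ∈ Icc α β, 1 ≤ g x ∧ 0 ≤ g' x ∧ 1 ≤ d x ∧ d' x ≤ 0)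
    (hW : ∀ x ∈ Icc α β, g x * d' x - g' x * d x = -w₀)
    (hαt : α ≤ t₁) (ht : t₁ < t₂) (htβ : t₂ ≤ β) (hk : 0 < k) (hqk : ∀ s ∈ Icc t₁ t₂, k ^ 2 ≤ q s)
    (hkℓ : 2 ≤ k * (t₂ - t₁)) {x : ℝ} (hx : x ∈ Icc α β) :
    g x * d x ≤ ((t₁ - α) + (β - t₂) + 4 / k) * w₀ := by
  have hg0 : ∀ x ∈ Icc α β, 0 ≤ g x := fun x hx ↦ zero_le_one.trans (hsign x hx).1
  have hg'0 : ∀ x ∈ Icc α β, 0 ≤ g' x := fun x hx ↦ (hsign x hx).2.1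
  have hd0 : ∀ x ∈ Icc α β, 0 ≤ d x := fun x hx ↦ zero_le_one.trans (hsign x hx).2.2.1
  have hd'0 : ∀ x ∈ Icc α β, d' x ≤ 0 := fun x hx ↦ (hsign x hx).2.2.2
  have hw₀ : 0 ≤ w₀ := by
    rw [← hg'β]; exact hg'0 β (right_mem_Icc.2 (hαt.trans (ht.le.trans htβ)))
  have hk4 : 0 ≤ 4 / k := by positivity
  obtain ⟨-, hinv⟩ := tanh_rate_pos_and_inv_le hk (sub_pos.2 ht)
  have hinv' : 1 / (k * Real.tanh (k * (t₂ - t₁))) ≤ 2 / k := hinv (by linarith)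
  have h24 : 2 / k ≤ 4 / k := div_le_div_of_nonneg_right (by norm_num) hk.le
  rcases le_or_gt x t₁ with hx₁ | hx₁
  · -- left tail
    have key := mul_le_of_left_tail hd hq0 hg0 hg'0 hd0 hd'0 hW hαt ht htβ hk hqk ⟨hx.1, hx₁⟩
    refine key.trans (mul_le_mul_of_nonneg_right ?_ hw₀)
    have : t₁ - x ≤ t₁ - α := by linarith [hx.1]
    linarith [htβ]
  rcases le_or_gt t₂ x with hx₂ | hx₂
  · -- right tail
    have key := mul_le_of_right_tail hg hq0 hg0 hg'0 hd0 hd'0 hW hαt ht htβ hk hqk ⟨hx₂, hx.2⟩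
    refine key.trans (mul_le_mul_of_nonneg_right ?_ hw₀)
    have : x - t₂ ≤ β - t₂ := by linarith [hx.2]
    linarith [hαt]
  · -- on the good interval
    obtain ⟨-, -, -, hzone⟩ := barrierBasis_depth_and_rates hg hd hq0 hgα hg'α hg'β hsign hW hαt ht htβ
      hk hqk hkℓ
    refine (hzone x ⟨hx₁.le, hx₂.le⟩).trans (mul_le_mul_of_nonneg_right ?_ hw₀)
    linarith [hαt, htβ]

end Literature.Analysis.ODE

end
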